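import Mathlib.NumberTheory.ModularForms.JacobiTheta.TwoVariable
import Mathlib.Analysis.Calculus.SmoothSeries
import Mathlib.Analysis.Normed.Ring.InfiniteSum
import HarnessLib

/-!
# The theta series `θ(y) = ∑ₙ e^{−πn²y}` on the positive axis: termwise derivatives and the
# Glaisher combination `∑_{m,n} (m⁴ − 6m²n² + n⁴) e^{−π(m²+n²)y} = 2θ·θ₍₄₎ − 6θ₍₂₎²`

Topic `Literature/Analysis/SpecialFunctions`. Elementary real analysis of the Jacobi theta series
restricted to the imaginary axis, `θ(y) := θ₃(iy) = ∑_{n∈ℤ} e^{−πn²y}` (`y > 0`), written out as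
`tsum`s (no new definitions):

* `summable_abs_pow_mul_exp_axis`, `summable_thetaMoment` — `∑ |n|ᵏ e^{−πn²y}`,
  `∑ (−πn²)ʲ e^{−πn²y}` converge (Mathlib's `summable_pow_mul_jacobiTheta₂_term_bound`);
* `hasDerivAt_tsum_thetaMoment` — **termwise differentiation**:
  `d/dy ∑ₙ (−πn²)ʲ e^{−πn²y} = ∑ₙ (−πn²)ʲ⁺¹ e^{−πn²y}` (`hasDerivAt_tsum_of_isPreconnected` on
  `(y/2, ∞)` with the majorant at `y/2`); in particular `θ′ = ∑ (−πn²)e^{−πn²y}`,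
  `θ″ = ∑ (−πn²)² e^{−πn²y}` (`hasDerivAt_theta_axis`, `hasDerivAt_deriv_theta_axis`);
* `glaisherLatticeSum_eq` — the Gaussian-lattice theta series with the harmonic weight
  `Re (m + in)⁴ = m⁴ − 6m²n² + n⁴` factors through the one-dimensional moments:
  `∑_{(m,n)∈ℤ²} (m⁴ − 6m²n² + n⁴) e^{−π(m²+n²)y} = 2 (∑ e^{−πn²y})(∑ n⁴e^{−πn²y}) − 6 (∑ n²e^{−πn²y})²`
  (`= (2θθ″ − 6θ′²)/π²`, `glaisherLatticeSum_eq_deriv`). This is the `q`-series side of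
  Glaisher's expression of `∑ (m + in)⁴ q^{m²+n²}` through `K, E` (Glaisher 1885; cf.
  Rogers–Wan–Zucker, Ramanujan J. 37 (2015), arXiv:1303.2259, eq. (25)), used for the cubic moments of `K`.

## References

* J. W. L. Glaisher, *On the quantities K, E, J, G, K′, E′, J′, G′ in elliptic functions*,
  Quart. J. Pure Appl. Math. 20 (1885) 313–361, §§ on `q`-series for `k²k′²K⁵`-type products.
* M. Rogers, J. G. Wan, I. J. Zucker, *Moments of elliptic integrals and critical `L`-values*,
  Ramanujan J. 37 (2015) 113–130, arXiv:1303.2259, §3 eq. (25).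
-/

noncomputable section

open Real _root_.Set _root_.Filter
open scoped _root_.Topology

namespace Literature.Analysis.SpecialFunctions

variable {y : ℝ}

/-! ### Summability -/

/-- `∑ₙ |n|ᵏ e^{−πn²y}` converges for `y > 0`. [folklore] -/
theorem summable_abs_pow_mul_exp_axis (k : ℕ) (hy : 0 < y) :
    Summable fun n : ℤ => |(n : ℝ)| ^ k * rexp (-π * (n : ℝ) ^ 2 * y) := by
  have h := summable_pow_mul_jacobiTheta₂_term_bound 0 hy k
  refine h.congr (fun n => ?_)
  rw [Int.cast_abs]
  congr 2
  ring

/-- The norm of the `j`-th moment term: `‖(−πn²)ʲ e^{−πn²t}‖ = πʲ|n|²ʲ e^{−πn²t}`. [folklore] -/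
theorem norm_thetaMoment_term (j : ℕ) (n : ℤ) (t : ℝ) :
    ‖(-π * (n : ℝ) ^ 2) ^ j * rexp (-π * (n : ℝ) ^ 2 * t)‖ =
      π ^ j * (|(n : ℝ)| ^ (2 * j) * rexp (-π * (n : ℝ) ^ 2 * t)) := by
  rw [norm_mul, norm_pow, Real.norm_eq_abs, Real.norm_eq_abs, abs_of_pos (Real.exp_pos _),
    show |-π * (n : ℝ) ^ 2| = π * |(n : ℝ)| ^ 2 by
      rw [abs_mul, abs_neg, abs_of_pos Real.pi_pos, abs_pow], mul_pow, ← pow_mul]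
  ring

/-- `∑ₙ (−πn²)ʲ e^{−πn²y}` converges absolutely for `y > 0`. [folklore] -/
theorem summable_norm_thetaMoment (j : ℕ) (hy : 0 < y) :
    Summable fun n : ℤ => ‖(-π * (n : ℝ) ^ 2) ^ j * rexp (-π * (n : ℝ) ^ 2 * y)‖ := by
  simp_rw [norm_thetaMoment_term]
  exact (summable_abs_pow_mul_exp_axis (2 * j) hy).mul_left _

/-- `∑ₙ (−πn²)ʲ e^{−πn²y}` converges for `y > 0`. [folklore] -/
theorem summable_thetaMoment (j : ℕ) (hy : 0 < y) :
    Summable fun n : ℤ => (-π * (n : ℝ) ^ 2) ^ j * rexp (-π * (n : ℝ) ^ 2 * y) :=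
  (summable_norm_thetaMoment j hy).of_norm

/-- `∑ₙ nᵏ e^{−πn²y}` (even `k = 2j`) converges absolutely for `y > 0`. [folklore] -/
theorem summable_norm_pow_mul_exp_axis (j : ℕ) (hy : 0 < y) :
    Summable fun n : ℤ => ‖(n : ℝ) ^ (2 * j) * rexp (-π * (n : ℝ) ^ 2 * y)‖ := by
  have h := summable_abs_pow_mul_exp_axis (2 * j) hy
  refine h.congr (fun n => ?_)
  rw [norm_mul, norm_pow, Real.norm_eq_abs, Real.norm_eq_abs, abs_of_pos (Real.exp_pos _)]

/-! ### Termwise differentiation -/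

/-- **Termwise differentiation of the theta moments**: for `y > 0`,
`d/dy ∑ₙ (−πn²)ʲ e^{−πn²y} = ∑ₙ (−πn²)ʲ⁺¹ e^{−πn²y}`. [folklore] -/
theorem hasDerivAt_tsum_thetaMoment (j : ℕ) (hy : 0 < y) :
    HasDerivAt (fun t => ∑' n : ℤ, (-π * (n : ℝ) ^ 2) ^ j * rexp (-π * (n : ℝ) ^ 2 * t))
      (∑' n : ℤ, (-π * (n : ℝ) ^ 2) ^ (j + 1) * rexp (-π * (n : ℝ) ^ 2 * y)) y := by
  have hy2 : 0 < y / 2 := half_pos hy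
  refine hasDerivAt_tsum_of_isPreconnected (t := Ioi (y / 2)) (y₀ := y)
    (u := fun n : ℤ => π ^ (j + 1) * (|(n : ℝ)| ^ (2 * (j + 1)) * rexp (-π * (n : ℝ) ^ 2 * (y / 2))))
    (g := fun (n : ℤ) (t : ℝ) => (-π * (n : ℝ) ^ 2) ^ j * rexp (-π * (n : ℝ) ^ 2 * t))
    (g' := fun (n : ℤ) (t : ℝ) => (-π * (n : ℝ) ^ 2) ^ (j + 1) * rexp (-π * (n : ℝ) ^ 2 * t))
    ((summable_abs_pow_mul_exp_axis _ hy2).mul_left _) isOpen_Ioi isPreconnected_Ioi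
    (fun n t _ => ?_) (fun n t ht => ?_) (by simp [hy]) (summable_thetaMoment j hy) (by simp [hy])
  · -- derivative of one term
    have h1 : HasDerivAt (fun t : ℝ => -π * (n : ℝ) ^ 2 * t) (-π * (n : ℝ) ^ 2) t := by
      have := (hasDerivAt_id t).const_mul (-π * (n : ℝ) ^ 2)
      simpa only [mul_one, id] using this
    have h2 := (h1.exp).const_mul ((-π * (n : ℝ) ^ 2) ^ j)
    refine h2.congr_deriv ?_
    ring
  · -- the majorant on `(y/2, ∞)`
    rw [norm_thetaMoment_term]
    have ht' : y / 2 ≤ t := le_of_lt ht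
    have hexp : rexp (-π * (n : ℝ) ^ 2 * t) ≤ rexp (-π * (n : ℝ) ^ 2 * (y / 2)) := by
      apply Real.exp_le_exp.mpr
      have : 0 ≤ π * (n : ℝ) ^ 2 := by positivity
      nlinarith
    have hp : 0 ≤ π ^ (j + 1) * |(n : ℝ)| ^ (2 * (j + 1)) := by positivity
    calc π ^ (j + 1) * (|(n : ℝ)| ^ (2 * (j + 1)) * rexp (-π * (n : ℝ) ^ 2 * t))
        = π ^ (j + 1) * |(n : ℝ)| ^ (2 * (j + 1)) * rexp (-π * (n : ℝ) ^ 2 * t) := by ring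
      _ ≤ π ^ (j + 1) * |(n : ℝ)| ^ (2 * (j + 1)) * rexp (-π * (n : ℝ) ^ 2 * (y / 2)) :=
          mul_le_mul_of_nonneg_left hexp hp
      _ = _ := by ring

/-- **`θ′(y) = ∑ₙ (−πn²) e^{−πn²y}`** for `θ(y) = ∑ₙ e^{−πn²y}`, `y > 0`. [folklore] -/
theorem hasDerivAt_theta_axis (hy : 0 < y) :
    HasDerivAt (fun t => ∑' n : ℤ, rexp (-π * (n : ℝ) ^ 2 * t))
      (∑' n : ℤ, (-π * (n : ℝ) ^ 2) * rexp (-π * (n : ℝ) ^ 2 * y)) y := by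
  have h := hasDerivAt_tsum_thetaMoment 0 hy
  simp only [pow_zero, one_mul, zero_add, pow_one] at h
  exact h

/-- **`θ″(y) = ∑ₙ (−πn²)² e^{−πn²y}`**: the derivative of `θ′`. [folklore] -/
theorem hasDerivAt_deriv_theta_axis (hy : 0 < y) :
    HasDerivAt (fun t => ∑' n : ℤ, (-π * (n : ℝ) ^ 2) * rexp (-π * (n : ℝ) ^ 2 * t))
      (∑' n : ℤ, (-π * (n : ℝ) ^ 2) ^ 2 * rexp (-π * (n : ℝ) ^ 2 * y)) y := by
  have h := hasDerivAt_tsum_thetaMoment 1 hy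
  simp only [pow_one] at h
  exact h

/-! ### The Glaisher lattice sum -/

/-- **The Glaisher combination**: for `y > 0`,
`∑_{(m,n)∈ℤ²} (m⁴ − 6m²n² + n⁴) e^{−π(m²+n²)y} = 2(∑ₙ e^{−πn²y})(∑ₙ n⁴e^{−πn²y}) − 6(∑ₙ n²e^{−πn²y})²`
(and the double series converges absolutely). [cite: RogersWanZucker2013, §3 eq. (25)] -/
theorem glaisherLatticeSum_eq (hy : 0 < y) :
    (Summable fun v : ℤ × ℤ => ((v.1 : ℝ) ^ 4 - 6 * (v.1 : ℝ) ^ 2 * (v.2 : ℝ) ^ 2 + (v.2 : ℝ) ^ 4) *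
        rexp (-π * ((v.1 : ℝ) ^ 2 + (v.2 : ℝ) ^ 2) * y)) ∧
    ∑' v : ℤ × ℤ, ((v.1 : ℝ) ^ 4 - 6 * (v.1 : ℝ) ^ 2 * (v.2 : ℝ) ^ 2 + (v.2 : ℝ) ^ 4) *
        rexp (-π * ((v.1 : ℝ) ^ 2 + (v.2 : ℝ) ^ 2) * y) =
      2 * (∑' n : ℤ, rexp (-π * (n : ℝ) ^ 2 * y)) * (∑' n : ℤ, (n : ℝ) ^ 4 * rexp (-π * (n : ℝ) ^ 2 * y)) -
        6 * (∑' n : ℤ, (n : ℝ) ^ 2 * rexp (-π * (n : ℝ) ^ 2 * y)) ^ 2 := by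
  -- the one-dimensional pieces `fₖ(n) = nᵏ e^{−πn²y}`, `k = 0, 2, 4`
  set f0 : ℤ → ℝ := fun n => rexp (-π * (n : ℝ) ^ 2 * y) with hf0
  set f2 : ℤ → ℝ := fun n => (n : ℝ) ^ 2 * rexp (-π * (n : ℝ) ^ 2 * y) with hf2
  set f4 : ℤ → ℝ := fun n => (n : ℝ) ^ 4 * rexp (-π * (n : ℝ) ^ 2 * y) with hf4
  have h0 : Summable fun n => ‖f0 n‖ := by
    refine (summable_norm_pow_mul_exp_axis 0 hy).congr (fun n => ?_)
    simp only [hf0, mul_zero, pow_zero, one_mul]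
  have h2 : Summable fun n => ‖f2 n‖ := by
    refine (summable_norm_pow_mul_exp_axis 1 hy).congr (fun n => ?_)
    simp only [hf2, mul_one]
  have h4 : Summable fun n => ‖f4 n‖ := by
    refine (summable_norm_pow_mul_exp_axis 2 hy).congr (fun n => ?_)
    simp only [hf4, show 2 * 2 = 4 from rfl]
  -- product families over `ℤ × ℤ`
  have hs40 : Summable fun v : ℤ × ℤ => f4 v.1 * f0 v.2 := summable_mul_of_summable_norm h4 h0
  have hs04 : Summable fun v : ℤ × ℤ => f0 v.1 * f4 v.2 := summable_mul_of_summable_norm h0 h4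
  have hs22 : Summable fun v : ℤ × ℤ => f2 v.1 * f2 v.2 := summable_mul_of_summable_norm h2 h2
  have ht40 : (∑' n, f4 n) * (∑' n, f0 n) = ∑' v : ℤ × ℤ, f4 v.1 * f0 v.2 :=
    tsum_mul_tsum_of_summable_norm h4 h0
  have ht04 : (∑' n, f0 n) * (∑' n, f4 n) = ∑' v : ℤ × ℤ, f0 v.1 * f4 v.2 :=
    tsum_mul_tsum_of_summable_norm h0 h4
  have ht22 : (∑' n, f2 n) * (∑' n, f2 n) = ∑' v : ℤ × ℤ, f2 v.1 * f2 v.2 :=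
    tsum_mul_tsum_of_summable_norm h2 h2
  -- the summand splits
  have hsplit : ∀ v : ℤ × ℤ, ((v.1 : ℝ) ^ 4 - 6 * (v.1 : ℝ) ^ 2 * (v.2 : ℝ) ^ 2 + (v.2 : ℝ) ^ 4) *
      rexp (-π * ((v.1 : ℝ) ^ 2 + (v.2 : ℝ) ^ 2) * y) =
      f4 v.1 * f0 v.2 - 6 * (f2 v.1 * f2 v.2) + f0 v.1 * f4 v.2 := by
    intro v
    have he : rexp (-π * ((v.1 : ℝ) ^ 2 + (v.2 : ℝ) ^ 2) * y) =
        rexp (-π * (v.1 : ℝ) ^ 2 * y) * rexp (-π * (v.2 : ℝ) ^ 2 * y) := by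
      rw [← Real.exp_add]; congr 1; ring
    simp only [hf0, hf2, hf4]
    rw [he]
    ring
  have hsum : Summable fun v : ℤ × ℤ => f4 v.1 * f0 v.2 - 6 * (f2 v.1 * f2 v.2) + f0 v.1 * f4 v.2 :=
    (hs40.sub (hs22.mul_left 6)).add hs04
  refine ⟨hsum.congr (fun v => (hsplit v).symm), ?_⟩
  rw [tsum_congr hsplit, (hs40.sub (hs22.mul_left 6)).tsum_add hs04, hs40.tsum_sub (hs22.mul_left 6),
    tsum_mul_left, ← ht40, ← ht04, sq, ← ht22]
  ring

/-- The same with the signed moments `∑ (−πn²)ʲe^{−πn²y}` (the derivatives of `θ`):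
`∑_{(m,n)} (m⁴ − 6m²n² + n⁴) e^{−π(m²+n²)y} = (2θθ″ − 6θ′²)/π²`. [cite: RogersWanZucker2013, §3 eq. (25)] -/
theorem glaisherLatticeSum_eq_deriv (hy : 0 < y) :
    ∑' v : ℤ × ℤ, ((v.1 : ℝ) ^ 4 - 6 * (v.1 : ℝ) ^ 2 * (v.2 : ℝ) ^ 2 + (v.2 : ℝ) ^ 4) *
        rexp (-π * ((v.1 : ℝ) ^ 2 + (v.2 : ℝ) ^ 2) * y) =
      (2 * (∑' n : ℤ, rexp (-π * (n : ℝ) ^ 2 * y)) *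
          (∑' n : ℤ, (-π * (n : ℝ) ^ 2) ^ 2 * rexp (-π * (n : ℝ) ^ 2 * y)) -
        6 * (∑' n : ℤ, (-π * (n : ℝ) ^ 2) * rexp (-π * (n : ℝ) ^ 2 * y)) ^ 2) / π ^ 2 := by
  rw [(glaisherLatticeSum_eq hy).2]
  have e4 : ∑' n : ℤ, (-π * (n : ℝ) ^ 2) ^ 2 * rexp (-π * (n : ℝ) ^ 2 * y) =
      π ^ 2 * ∑' n : ℤ, (n : ℝ) ^ 4 * rexp (-π * (n : ℝ) ^ 2 * y) := by
    rw [← tsum_mul_left]; refine tsum_congr (fun n => ?_); ring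
  have e2 : ∑' n : ℤ, (-π * (n : ℝ) ^ 2) * rexp (-π * (n : ℝ) ^ 2 * y) =
      -π * ∑' n : ℤ, (n : ℝ) ^ 2 * rexp (-π * (n : ℝ) ^ 2 * y) := by
    rw [← tsum_mul_left]; refine tsum_congr (fun n => ?_); ring
  rw [e4, e2]
  have hπ : π ≠ 0 := Real.pi_pos.ne'
  rw [eq_div_iff (pow_ne_zero 2 hπ)]
  ring

end Literature.Analysis.SpecialFunctions

end
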